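import Summits.QuantumAdvantage.QuantumAdvantage.Theorems.ArithStatLadderAcZeroRungDefs

/-!
# Crux `ArithStatLadder.AcZeroRung` (stmt-QuantumAdvantage-2425), line `dyadic-chirp-poisson`:
# lemmas for STUB G1 `stub_walshBias` (helper file 1/2, anchor `walshBias_digitRep`)

Helper file of the registered stub `stub_walshBias : DyadicTwistBound → WalshBiasQP` of the checked
skeleton of the crux (lead `prover-line-stmt-QuantumAdvantage-2425-0`); the stub itself is proved in
`ArithStatLadderAcZeroRungWalshBias.lean`, which imports this module.

ONE SIGNED BINARY DIGIT IS `ℓ¹`-CHEAP IN DYADIC ADDITIVE CHARACTERS (anchor `walshBias_digitRep`): for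
`j < n`, `d ↦ sgn(bit_j d)` is a finite combination `Σ_i c_i e(a_i d/2ⁿ)`, `a_i ∈ ℤ`, with
`Σ_i |c_i| ≤ 2(n+1)`. This is the bookkeeping engine of `stub_walshBias` (Walsh characters are products
of signed digits; representations multiply).

Proof outline (pure finite Fourier analysis on `ℤ/2^{j+1}`, `M = 2^{j+1}`).
* `e(x) = exp(2πix)`: multiplicativity, `|e| = 1`, `e(ℤ) = 1`, `e(x) = 1 ↔ x ∈ ℤ`, and the Jordan-type
  bound `4|t| ≤ |e(t) − 1|` for `|t| ≤ 1/2` (`|e(t) − 1| = 2|sin πt|`, Mathlib `Real.le_sin_mul`).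
* orthogonality `Σ_{u<M} e(uk/M) = M·[M ∣ k]` (geometric sum of `M`-th roots of unity), hence the
  residue-class indicator `[d ≡ y (M)] = M⁻¹ Σ_{u<M} e(ud/M) e(−uy/M)`.
* `bit_j d = 1 ↔ 2^j ≤ d mod M`, so `[bit_j d = 1] = Σ_{u<M} λ_u e(ud/M)` with
  `λ_u = M⁻¹ Σ_{2^j ≤ y < M} e(−uy/M)` (`sgn_testBit_eq`); `|λ_u| ≤ 1/2` trivially, and for `0 < u < M`
  the geometric sum gives `|λ_u| ≤ M⁻¹ · 2/|e(−u/M) − 1| ≤ (1/u + 1/(M−u))/2`; with the dyadic-block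
  bound `Σ_{1 ≤ u < 2^k} 1/u ≤ k` the mass is `Σ_u |λ_u| ≤ j + 3/2`, so `sgn(bit_j) = 1 − 2[bit_j = 1]`
  has mass `≤ 2j + 4 ≤ 2(n+1)`.
* "representation of level `n` and mass `≤ B`" is stated inline as the existential
  `∃ (ι : Type) (_ : Fintype ι) (c : ι → ℂ) (a : ι → ℤ), (∀ d, f d = Σ_i c_i e(a_i d/2ⁿ)) ∧ Σ_i |c_i| ≤ B`
  (no `Prop`-valued definitions); closure under `1`, sums, scalars is recorded here, products in the
  stub file.
-/

set_option linter.dupNamespace false -- D-0017: single-problem summit ⇒ QuantumAdvantage.QuantumAdvantage by design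

noncomputable section

namespace Summit.QuantumAdvantage.QuantumAdvantage.Theorems.AcZeroRung

open scoped BigOperators Classical
open Filter Finset
open Literature.Probability.RandomGraphs.LowDegree (sgn walsh sgn_true sgn_false)
open Summit.QuantumAdvantage.QuantumAdvantage.Theorems.AcZeroRung.Negative (famD mem_famD)

namespace WalshBias

/-! ## The additive character `e(x) = exp(2πix)` of the line (`AcZeroRung.e`)

Multiplicativity, `|e| = 1`, `e(kx) = e(x)^k` are one-line computations with `Complex.exp` and are
done inline where used (the tree's `LargeSieve.e` / `VdC.e` APIs concern other constants). -/

/-- `e(x) = 1` iff `x` is an integer. -/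
theorem e_eq_one_iff (x : ℝ) : e x = 1 ↔ ∃ q : ℤ, x = q := by
  have h2 : (2 * Real.pi * Complex.I : ℂ) ≠ 0 := by simp [Real.pi_ne_zero]
  unfold e
  rw [Complex.exp_eq_one_iff]
  constructor
  · rintro ⟨q, hq⟩
    have : (x : ℂ) = q := by
      rw [mul_comm (q:ℂ)] at hq
      exact mul_left_cancel₀ h2 hq
    exact ⟨q, by exact_mod_cast this⟩
  · rintro ⟨q, rfl⟩
    exact ⟨q, by push_cast; ring⟩

/-- `4|t| ≤ |e(t) − 1|` for `|t| ≤ 1/2` (`|e(t) − 1| = 2|sin πt|` and Jordan's inequality). -/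
theorem four_mul_abs_le_norm_e_sub_one {t : ℝ} (ht : |t| ≤ 1 / 2) : 4 * |t| ≤ ‖e t - 1‖ := by
  have h1 : ‖e t - 1‖ = 2 * |Real.sin (Real.pi * t)| := by
    unfold e
    rw [show (2 * Real.pi * Complex.I * (t:ℂ)) = Complex.I * ((2 * Real.pi * t : ℝ) : ℂ) by
      push_cast; ring, Complex.norm_exp_I_mul_ofReal_sub_one, Real.norm_eq_abs, abs_mul, abs_two]
    congr 2; ring
  have h2 : 2 * |t| ≤ Real.sin (Real.pi * |t|) := by
    have := Real.le_sin_mul (x := 2 * |t|) (by positivity) (by linarith)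
    rwa [show Real.pi / 2 * (2 * |t|) = Real.pi * |t| by ring] at this
  have h3 : Real.sin (Real.pi * |t|) ≤ |Real.sin (Real.pi * t)| := by
    rcases abs_choice t with h | h <;> rw [h]
    · exact le_abs_self _
    · rw [mul_neg, Real.sin_neg]; exact neg_le_abs _
  linarith

/-! ## Orthogonality of the characters mod `M` and the residue-class indicator -/

/-- `Σ_{u<M} e(uk/M) = M·[M ∣ k]` (geometric sum of `M`-th roots of unity). -/
theorem sum_e_eq (M : ℕ) (hM : 0 < M) (k : ℤ) :
    ∑ u ∈ range M, e (u * k / M) = if (M:ℤ) ∣ k then (M:ℂ) else 0 := by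
  have hz : ∀ u : ℕ, e (u * k / M) = e (k / M) ^ u := fun u => by
    unfold e; rw [← Complex.exp_nat_mul]; congr 1; push_cast; ring
  have hM' : (M:ℝ) ≠ 0 := by positivity
  have hpow : e (k / M) ^ M = 1 := by
    rw [← hz M, show ((M:ℕ):ℝ) * (k:ℝ) / M = ((k:ℤ):ℝ) by field_simp]
    exact (e_eq_one_iff _).mpr ⟨k, rfl⟩
  simp_rw [hz]
  split_ifs with h
  · obtain ⟨q, hq⟩ := h
    have h1 : e (k / M) = 1 := (e_eq_one_iff _).mpr ⟨q, by rw [hq]; push_cast; field_simp⟩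
    rw [h1]; simp
  · have hne : e (k / M) ≠ 1 := by
      intro h1
      apply h
      obtain ⟨q, hq⟩ := (e_eq_one_iff _).mp h1
      refine ⟨q, ?_⟩
      rw [div_eq_iff hM'] at hq
      exact_mod_cast hq.trans (mul_comm _ _)
    rw [geom_sum_eq hne, hpow, sub_self, zero_div]

/-- `[d ≡ y (M)] = M⁻¹ Σ_{u<M} e(ud/M) e(−uy/M)` for `y < M`. -/
theorem indicator_eq (M : ℕ) (hM : 0 < M) (d y : ℕ) (hy : y < M) :
    (if d % M = y then (1:ℂ) else 0) =
      (1 / M) * ∑ u ∈ range M, e (u / M * d) * e (-(u / M * y)) := by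
  have h1 : ∀ u : ℕ, e (u / M * d) * e (-(u / M * y)) = e (u * ((d:ℤ) - y : ℤ) / M) := fun u => by
    unfold e; rw [← Complex.exp_add]; congr 1; push_cast; ring
  simp_rw [h1, sum_e_eq M hM]
  have hiff : (M:ℤ) ∣ (d:ℤ) - y ↔ d % M = y := by
    rw [← Nat.modEq_iff_dvd, Nat.ModEq, Nat.mod_eq_of_lt hy, eq_comm]
  have hM' : (M:ℂ) ≠ 0 := by exact_mod_cast hM.ne'
  by_cases h : d % M = y
  · rw [if_pos h, if_pos (hiff.mpr h)]; field_simp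
  · rw [if_neg h, if_neg (mt hiff.mp h), mul_zero]

/-! ## Finite combinations of dyadic additive characters (stated inline)

"`f` has a representation of level `n` and mass `≤ B`" is the proposition
`∃ (ι : Type) (_ : Fintype ι) (c : ι → ℂ) (a : ι → ℤ),
  (∀ d : ℕ, f d = ∑ i, c i * e ((a i : ℝ) / (2:ℝ) ^ n * d)) ∧ ∑ i, ‖c i‖ ≤ B`. -/

/-- An explicit combination of the characters `e(ud/2^m)`, `u ∈ s`, `m ≤ n`, is a representation of
level `n` with mass its coefficient sum. -/
theorem rep_of_finset {n m : ℕ} (hm : m ≤ n) {B : ℝ} {f : ℕ → ℂ} (s : Finset ℕ) (c : ℕ → ℂ)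
    (hf : ∀ d, f d = ∑ u ∈ s, c u * e (u / (2:ℝ) ^ m * d)) (hB : ∑ u ∈ s, ‖c u‖ ≤ B) :
    ∃ (ι : Type) (_ : Fintype ι) (c : ι → ℂ) (a : ι → ℤ),
      (∀ d : ℕ, f d = ∑ i, c i * e ((a i : ℝ) / (2:ℝ) ^ n * d)) ∧ ∑ i, ‖c i‖ ≤ B := by
  obtain ⟨k, rfl⟩ := Nat.exists_eq_add_of_le hm
  have ha : ∀ u : ℕ, (((u * 2 ^ k : ℕ) : ℤ) : ℝ) / (2:ℝ) ^ (m + k) = u / (2:ℝ) ^ m := fun u => by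
    push_cast; rw [pow_add]; field_simp
  refine ⟨↥s, inferInstance, fun u => c u, fun u => ((u * 2 ^ k : ℕ) : ℤ), fun d => ?_, ?_⟩
  · rw [hf d, ← Finset.sum_coe_sort s (fun u => c u * e (u / (2:ℝ) ^ m * d))]
    simp_rw [ha]
  · rwa [Finset.sum_coe_sort s (fun u => ‖c u‖)]

/-- The constant `1` (mass `1`). -/
theorem rep_one (n : ℕ) : ∃ (ι : Type) (_ : Fintype ι) (c : ι → ℂ) (a : ι → ℤ),
    (∀ d : ℕ, (1:ℂ) = ∑ i, c i * e ((a i : ℝ) / (2:ℝ) ^ n * d)) ∧ ∑ i, ‖c i‖ ≤ 1 :=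
  ⟨Unit, inferInstance, fun _ => 1, fun _ => 0, fun d => by simp [e], by simp⟩

/-- Sums (masses add). -/
theorem rep_add {n : ℕ} {B₁ B₂ : ℝ} {f g : ℕ → ℂ}
    (h₁ : ∃ (ι : Type) (_ : Fintype ι) (c : ι → ℂ) (a : ι → ℤ),
      (∀ d : ℕ, f d = ∑ i, c i * e ((a i : ℝ) / (2:ℝ) ^ n * d)) ∧ ∑ i, ‖c i‖ ≤ B₁)
    (h₂ : ∃ (ι : Type) (_ : Fintype ι) (c : ι → ℂ) (a : ι → ℤ),
      (∀ d : ℕ, g d = ∑ i, c i * e ((a i : ℝ) / (2:ℝ) ^ n * d)) ∧ ∑ i, ‖c i‖ ≤ B₂) :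
    ∃ (ι : Type) (_ : Fintype ι) (c : ι → ℂ) (a : ι → ℤ),
      (∀ d : ℕ, f d + g d = ∑ i, c i * e ((a i : ℝ) / (2:ℝ) ^ n * d)) ∧ ∑ i, ‖c i‖ ≤ B₁ + B₂ := by
  obtain ⟨ι₁, _, c₁, a₁, hf₁, hc₁⟩ := h₁
  obtain ⟨ι₂, _, c₂, a₂, hf₂, hc₂⟩ := h₂
  refine ⟨ι₁ ⊕ ι₂, inferInstance, Sum.elim c₁ c₂, Sum.elim a₁ a₂, fun d => ?_, ?_⟩
  · simp [Fintype.sum_sum_type, hf₁ d, hf₂ d]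
  · simp only [Fintype.sum_sum_type, Sum.elim_inl, Sum.elim_inr]; exact add_le_add hc₁ hc₂

/-- Scalar multiples (mass scales). -/
theorem rep_smul {n : ℕ} {B : ℝ} {f : ℕ → ℂ} (z : ℂ)
    (h : ∃ (ι : Type) (_ : Fintype ι) (c : ι → ℂ) (a : ι → ℤ),
      (∀ d : ℕ, f d = ∑ i, c i * e ((a i : ℝ) / (2:ℝ) ^ n * d)) ∧ ∑ i, ‖c i‖ ≤ B) :
    ∃ (ι : Type) (_ : Fintype ι) (c : ι → ℂ) (a : ι → ℤ),
      (∀ d : ℕ, z * f d = ∑ i, c i * e ((a i : ℝ) / (2:ℝ) ^ n * d)) ∧ ∑ i, ‖c i‖ ≤ ‖z‖ * B := by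
  obtain ⟨ι, _, c, a, hf, hc⟩ := h
  refine ⟨ι, ‹_›, fun i => z * c i, a, fun d => ?_, ?_⟩
  · rw [hf d, Finset.mul_sum]; simp [mul_assoc]
  · simp only [norm_mul, ← Finset.mul_sum]; exact mul_le_mul_of_nonneg_left hc (norm_nonneg z)

/-! ## One binary digit -/

/-- `bit_j d = 1 ↔ 2^j ≤ d mod 2^{j+1}`. -/
theorem testBit_eq_true_iff (d j : ℕ) : Nat.testBit d j = true ↔ 2 ^ j ≤ d % 2 ^ (j + 1) := by
  rw [Nat.testBit_eq_decide_div_mod_eq, decide_eq_true_eq, Nat.mod_pow_succ]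
  have h1 : d % 2 ^ j < 2 ^ j := Nat.mod_lt d (Nat.two_pow_pos j)
  rcases Nat.mod_two_eq_zero_or_one (d / 2 ^ j) with h0 | h0
  · rw [h0, mul_zero, add_zero]
    exact ⟨fun h => absurd h (by norm_num), fun h => absurd h1 (not_lt.mpr h)⟩
  · rw [h0, mul_one]
    exact ⟨fun _ => Nat.le_add_left _ _, fun _ => rfl⟩

/-! The Fourier coefficient at `u` of the digit indicator `[bit_j = 1]` on `ℤ/2^{j+1}` is
`λ_u = 2^{-(j+1)} Σ_{2^j ≤ y < 2^{j+1}} e(−uy/2^{j+1})`; it is written out in full below. -/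

/-- Fourier expansion of one signed digit: `sgn(bit_j d) = 1 − 2 Σ_{u<2^{j+1}} λ_u e(ud/2^{j+1})`. -/
theorem sgn_testBit_eq (j d : ℕ) : (sgn (Nat.testBit d j) : ℂ) =
    1 - 2 * ∑ u ∈ range (2 ^ (j + 1)),
      ((1 / (2:ℂ) ^ (j + 1)) * ∑ y ∈ Ico (2 ^ j : ℕ) (2 ^ (j + 1)), e (-((u:ℝ) / (2:ℝ) ^ (j + 1) * y))) *
        e (u / (2:ℝ) ^ (j + 1) * d) := by
  have hM : 0 < 2 ^ (j + 1) := Nat.two_pow_pos _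
  have h1 : (sgn (Nat.testBit d j) : ℂ) = 1 - 2 * (if 2 ^ j ≤ d % 2 ^ (j + 1) then 1 else 0) := by
    cases h : Nat.testBit d j
    · have h' : ¬ (2 ^ j ≤ d % 2 ^ (j + 1)) := fun h'' => by
        rw [← testBit_eq_true_iff] at h''; rw [h''] at h; exact Bool.noConfusion h
      rw [if_neg h', sgn_false]; push_cast; ring
    · rw [if_pos ((testBit_eq_true_iff d j).mp h), sgn_true]; push_cast; ring
  have h2 : (if 2 ^ j ≤ d % 2 ^ (j + 1) then (1:ℂ) else 0) =
      ∑ y ∈ Ico (2 ^ j : ℕ) (2 ^ (j + 1)), if d % 2 ^ (j + 1) = y then (1:ℂ) else 0 := by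
    rw [Finset.sum_ite_eq]
    simp only [Finset.mem_Ico, Nat.mod_lt d hM, and_true]
  have h3 : ∀ y ∈ Ico (2 ^ j : ℕ) (2 ^ (j + 1)), (if d % 2 ^ (j + 1) = y then (1:ℂ) else 0) =
      (1 / (2 ^ (j + 1) : ℕ)) * ∑ u ∈ range (2 ^ (j + 1)),
        e (u / (2 ^ (j + 1) : ℕ) * d) * e (-(u / (2 ^ (j + 1) : ℕ) * y)) :=
    fun y hy => indicator_eq (2 ^ (j + 1)) hM d y (Finset.mem_Ico.mp hy).2
  rw [h1, h2, Finset.sum_congr rfl h3]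
  push_cast
  congr 2
  simp only [Finset.mul_sum, Finset.sum_mul]
  rw [Finset.sum_comm]
  exact Finset.sum_congr rfl fun u _ => Finset.sum_congr rfl fun y _ => by ring

/-- The trivial bound `|λ_u| ≤ 1/2`. -/
theorem norm_lam_le (j u : ℕ) :
    ‖(1 / (2:ℂ) ^ (j + 1)) * ∑ y ∈ Ico (2 ^ j : ℕ) (2 ^ (j + 1)), e (-((u:ℝ) / (2:ℝ) ^ (j + 1) * y))‖ ≤
      1 / 2 := by
  have hn : ∀ x : ℝ, ‖e x‖ = 1 := fun x => by simp [e, Complex.norm_exp]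
  rw [norm_mul]
  have hc : ((Ico (2 ^ j : ℕ) (2 ^ (j + 1))).card : ℝ) = 2 ^ j := by
    rw [Nat.card_Ico, pow_succ, show 2 ^ j * 2 - 2 ^ j = 2 ^ j by omega]; push_cast; ring
  have h1 : ‖∑ y ∈ Ico (2 ^ j : ℕ) (2 ^ (j + 1)), e (-((u:ℝ) / (2:ℝ) ^ (j + 1) * y))‖ ≤ 2 ^ j := by
    refine (norm_sum_le _ _).trans ?_
    simp only [hn, Finset.sum_const, nsmul_eq_mul, mul_one, hc, le_refl]
  have h2 : ‖(1 / (2:ℂ) ^ (j + 1))‖ = 1 / 2 ^ (j + 1) := by simp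
  rw [h2]
  calc 1 / 2 ^ (j + 1) * ‖∑ y ∈ Ico (2 ^ j : ℕ) (2 ^ (j + 1)), e (-((u:ℝ) / (2:ℝ) ^ (j + 1) * y))‖
      ≤ 1 / 2 ^ (j + 1) * 2 ^ j := by gcongr
    _ = 1 / 2 := by rw [pow_succ]; field_simp

/-- The decay bound `|λ_u| ≤ (1/u + 1/(2^{j+1} − u))/2` for `0 < u < 2^{j+1}` (geometric sum + Jordan). -/
theorem norm_lam_le_of_mem (j u : ℕ) (hu : u ∈ Ico (1:ℕ) (2 ^ (j + 1))) :
    ‖(1 / (2:ℂ) ^ (j + 1)) * ∑ y ∈ Ico (2 ^ j : ℕ) (2 ^ (j + 1)), e (-((u:ℝ) / (2:ℝ) ^ (j + 1) * y))‖ ≤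
      (1 / 2) * (1 / (u:ℝ) + 1 / ((2:ℝ) ^ (j + 1) - u)) := by
  have hn : ∀ x : ℝ, ‖e x‖ = 1 := fun x => by simp [e, Complex.norm_exp]
  obtain ⟨hu1, hu2⟩ := Finset.mem_Ico.mp hu
  set M : ℝ := (2:ℝ) ^ (j + 1) with hM
  have hMpos : 0 < M := by positivity
  have hu1' : (1:ℝ) ≤ u := by exact_mod_cast hu1
  have hu2' : (u:ℝ) + 1 ≤ M := by rw [hM]; exact_mod_cast hu2
  set w : ℂ := e (-((u:ℝ) / M)) with hw
  -- the coefficient is a geometric sum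
  have hy : ∀ y : ℕ, e (-((u:ℝ) / M * y)) = w ^ y := fun y => by
    rw [hw]; unfold e; rw [← Complex.exp_nat_mul]; congr 1; push_cast; ring
  have hsum : ∑ y ∈ Ico (2 ^ j : ℕ) (2 ^ (j + 1)), e (-((u:ℝ) / M * y)) =
      w ^ (2 ^ j) * ∑ k ∈ range (2 ^ j), w ^ k := by
    simp_rw [hy]
    rw [Finset.sum_Ico_eq_sum_range, pow_succ, show 2 ^ j * 2 - 2 ^ j = 2 ^ j by omega,
      Finset.mul_sum]
    exact Finset.sum_congr rfl fun k _ => by rw [pow_add]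
  -- `|Σ_{k<2^j} w^k| · |w − 1| ≤ 2`
  have hgeom : ‖∑ k ∈ range (2 ^ j), w ^ k‖ * ‖w - 1‖ ≤ 2 := by
    rw [← norm_mul, geom_sum_mul]
    refine (norm_sub_le _ _).trans ?_
    rw [norm_pow, hw, hn, one_pow, norm_one]; norm_num
  -- `|w − 1| ≥ 4τ` with `1/(Mτ) ≤ 1/u + 1/(M − u)`
  obtain ⟨τ, hτ, hτw, hτu⟩ : ∃ τ : ℝ, 0 < τ ∧ 4 * τ ≤ ‖w - 1‖ ∧
      1 / (M * τ) ≤ 1 / (u:ℝ) + 1 / (M - u) := by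
    rcases le_total (2 * (u:ℝ)) M with h | h
    · refine ⟨u / M, by positivity, ?_, ?_⟩
      · have := four_mul_abs_le_norm_e_sub_one (t := -((u:ℝ) / M))
          (by rw [abs_neg, abs_of_nonneg (by positivity), div_le_iff₀ hMpos]; linarith)
        rwa [abs_neg, abs_of_nonneg (by positivity)] at this
      · rw [mul_div_cancel₀ _ hMpos.ne']
        have : 0 ≤ 1 / (M - u) := by apply div_nonneg zero_le_one; linarith
        linarith
    · refine ⟨(M - u) / M, by apply div_pos <;> linarith, ?_, ?_⟩
      · have h0 : 0 ≤ (M - u) / M := by apply div_nonneg <;> linarith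
        have := four_mul_abs_le_norm_e_sub_one (t := (M - u) / M)
          (by rw [abs_of_nonneg h0, div_le_iff₀ hMpos]; linarith)
        have he : e ((M - u) / M) = w := by
          rw [hw, show (M - u) / M = -((u:ℝ) / M) + 1 by field_simp; ring]
          unfold e; push_cast
          rw [mul_add, Complex.exp_add, mul_one, Complex.exp_two_pi_mul_I, mul_one]
        rwa [abs_of_nonneg h0, he] at this
      · rw [mul_div_cancel₀ _ hMpos.ne']
        have : 0 ≤ 1 / (u:ℝ) := by positivity
        linarith
  -- assemble
  have hS : ‖∑ k ∈ range (2 ^ j), w ^ k‖ ≤ 1 / (2 * τ) := by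
    rw [le_div_iff₀ (by positivity)]
    nlinarith [norm_nonneg (∑ k ∈ range (2 ^ j), w ^ k)]
  rw [norm_mul, hsum, norm_mul, norm_pow, hw, hn, one_pow, one_mul,
    show ‖(1 / (2:ℂ) ^ (j + 1))‖ = 1 / M by rw [hM]; simp]
  calc 1 / M * ‖∑ k ∈ range (2 ^ j), w ^ k‖ ≤ 1 / M * (1 / (2 * τ)) := by gcongr
    _ = (1 / 2) * (1 / (M * τ)) := by field_simp
    _ ≤ (1 / 2) * (1 / (u:ℝ) + 1 / (M - u)) := by gcongr

/-- Dyadic blocks: `Σ_{1 ≤ u < 2^k} 1/u ≤ k`. -/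
theorem sum_Ico_one_div_le (k : ℕ) : ∑ u ∈ Ico (1:ℕ) (2 ^ k), 1 / (u:ℝ) ≤ k := by
  induction k with
  | zero => simp
  | succ k ih =>
    have h12 : 2 ^ k ≤ 2 ^ (k + 1) := Nat.pow_le_pow_right two_pos (by omega)
    rw [← Finset.sum_Ico_consecutive _ (Nat.one_le_two_pow (n := k)) h12]
    have hblock : ∑ u ∈ Ico (2 ^ k : ℕ) (2 ^ (k + 1)), 1 / (u:ℝ) ≤ 1 := by
      calc ∑ u ∈ Ico (2 ^ k : ℕ) (2 ^ (k + 1)), 1 / (u:ℝ)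
          ≤ ∑ u ∈ Ico (2 ^ k : ℕ) (2 ^ (k + 1)), 1 / (2:ℝ) ^ k :=
            Finset.sum_le_sum fun u hu => by
              have : (2:ℝ) ^ k ≤ u := by exact_mod_cast (Finset.mem_Ico.mp hu).1
              exact one_div_le_one_div_of_le (by positivity) this
        _ = 1 := by
            rw [Finset.sum_const, Nat.card_Ico, nsmul_eq_mul, pow_succ,
              show 2 ^ k * 2 - 2 ^ k = 2 ^ k by omega]
            push_cast; field_simp
    push_cast; linarith

/-- The `ℓ¹` mass of one digit indicator: `Σ_{u<2^{j+1}} |λ_u| ≤ j + 3/2`. -/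
theorem sum_norm_lam_le (j : ℕ) : ∑ u ∈ range (2 ^ (j + 1)),
    ‖(1 / (2:ℂ) ^ (j + 1)) * ∑ y ∈ Ico (2 ^ j : ℕ) (2 ^ (j + 1)), e (-((u:ℝ) / (2:ℝ) ^ (j + 1) * y))‖ ≤
      (j : ℝ) + 3 / 2 := by
  rw [Finset.range_eq_Ico, Finset.sum_eq_sum_Ico_succ_bot (Nat.two_pow_pos _)]
  have h1 := Finset.sum_le_sum fun u (hu : u ∈ Ico (1:ℕ) (2 ^ (j + 1))) => norm_lam_le_of_mem j u hu
  have h2 : ∑ u ∈ Ico (1:ℕ) (2 ^ (j + 1)), 1 / ((2:ℝ) ^ (j + 1) - u) =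
      ∑ u ∈ Ico (1:ℕ) (2 ^ (j + 1)), 1 / (u:ℝ) := by
    refine Finset.sum_nbij' (fun u => 2 ^ (j + 1) - u) (fun u => 2 ^ (j + 1) - u) ?_ ?_ ?_ ?_ ?_
    · intro u hu; simp only [Finset.mem_Ico] at hu ⊢; omega
    · intro u hu; simp only [Finset.mem_Ico] at hu ⊢; omega
    · intro u hu; simp only [Finset.mem_Ico] at hu; omega
    · intro u hu; simp only [Finset.mem_Ico] at hu; omega
    · intro u hu
      simp only [Finset.mem_Ico] at hu
      rw [Nat.cast_sub hu.2.le]; push_cast; ring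
  have h3 := sum_Ico_one_div_le (j + 1)
  refine (add_le_add (norm_lam_le j 0) h1).trans ?_
  rw [← Finset.mul_sum, Finset.sum_add_distrib, h2]
  push_cast at h3; linarith

end WalshBias

open WalshBias in
/-- **ONE SIGNED DIGIT is `ℓ¹`-cheap** (registered helper `walshBias_digitRep` of stub `stub_walshBias`):
for `j < n`, `sgn(bit_j d) = Σ_i c_i e(a_i d/2ⁿ)` for all `d`, with `a_i ∈ ℤ` and `Σ_i |c_i| ≤ 2(n+1)`
(mass `1 + 2(j + 3/2) = 2j + 4 ≤ 2(n+1)` from `sum_norm_lam_le`). -/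
theorem walshBias_digitRep : ∀ n j : ℕ, j < n → ∃ (ι : Type) (_ : Fintype ι) (c : ι → ℂ) (a : ι → ℤ), (∀ d : ℕ, (sgn (Nat.testBit d j) : ℂ) = ∑ i, c i * e ((a i : ℝ) / (2:ℝ) ^ n * d)) ∧ ∑ i, ‖c i‖ ≤ 2 * ((n:ℝ) + 1) := by
  intro n j hj
  have hg := rep_of_finset (Nat.succ_le_of_lt hj) (range (2 ^ (j + 1)))
    (fun u => (1 / (2:ℂ) ^ (j + 1)) *
      ∑ y ∈ Ico (2 ^ j : ℕ) (2 ^ (j + 1)), e (-((u:ℝ) / (2:ℝ) ^ (j + 1) * y)))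
    (f := fun d => ∑ u ∈ range (2 ^ (j + 1)), ((1 / (2:ℂ) ^ (j + 1)) *
      ∑ y ∈ Ico (2 ^ j : ℕ) (2 ^ (j + 1)), e (-((u:ℝ) / (2:ℝ) ^ (j + 1) * y))) *
        e (u / (2:ℝ) ^ (j + 1) * d))
    (fun _ => rfl) (sum_norm_lam_le j)
  obtain ⟨ι, _, c, a, hf, hc⟩ := rep_add (rep_one n) (rep_smul (-2) hg)
  refine ⟨ι, ‹_›, c, a, fun d => ?_, hc.trans ?_⟩
  · rw [← hf d, sgn_testBit_eq]; ring
  · have : (j:ℝ) + 1 ≤ n := by exact_mod_cast hj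
    simp only [norm_neg, Complex.norm_ofNat]; linarith

end Summit.QuantumAdvantage.QuantumAdvantage.Theorems.AcZeroRung

end
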